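import Summits.AtomisticToContinuum.BoseEinsteinCondensation.Theses.BECBoundaryReservoir

/-!
# Crux `ShellPenetration` (stmt-AtomisticToContinuum-8767) — line `existence-rigidity` (strategist, 2026-08-17)

Second alternative skeleton (published UNREGISTERED, see `Lines/dichotomy.lean` for why): the same
IDEAL | INTERACTING dichotomy and reservoir window as line `dichotomy`, but the open interacting content is
cut DIFFERENTLY from the birth line — by EXISTENCE versus RIGIDITY of the condensate instead of birth's
"k = 0 locking versus local equipartition":

* `stub_idealResonance`, `stub_interactingWindow` — as in line `dichotomy`;
* `stub_pinnedBEC` (EXISTENCE; the hardest stub, summit-hard) — for interacting `v`, small `ρ` and EVERY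
  `(w, κ)`: the near-minimisers of the shell-pinned energy eventually have `λ_max(γ_Ψ) ≥ c_A N`
  (`maxOccupation`), i.e. plain BEC for the pinned dilute gas in its TEXTBOOK form — the form in which any future
  condensation theorem for a box Hamiltonian with a boundary term would arrive (transferable), no mode named;
* `stub_condensateRigidity` (RIGIDITY; open, but of a different kind) — for interacting `v` and every
  `(w, κ, θ, Θ, c_A)`: if eventually the near-minimisers sit in the window AND condense (`λ_max ≥ c_A N`), then
  the crux's per-ball clause holds: the condensate, granted its existence, is flat at unit scale on the bulk and
  Josephson-locked to the reservoir mode `g` with the cross terms `⟨1_B,(γ − λ₁P₁)g⟩` under control. The lever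
  available here and nowhere else: `δ` is chosen after `n`, so near-minimisers are the exact ground state in
  disguise, which is unique and strictly positive (the pinned `H` is stoquastic: `−κ|g⟩⟨g|` has kernel
  `−κ|S|⁻¹1_S⊗1_S ≤ 0`), hence `γ₀` has a positive kernel and a positive top eigenmode (Perron–Frobenius), and
  the locked regime is parametrically deep (`E_J ≍ ρL` against `E_c ≍ a/(wL²)`).

Composition `shellPenetration_of_stubs` (kernel-checked, no `sorry` of its own): `by_cases` on the null set;
interacting case: `ρ₀ := min ρ₀ᵂ (min ρ₀ᴬ ρ₀ᴿ)`, window parameters from stub 2, `c_A` from stub 3 at the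
chosen `(w, κ)`, window ∧ BEC on the intersection of the eventual sets at slack `min`, `c` from stub 4, and
positivity of the occupation from the floor. `ShellPenetration_of` is the ONLY theorem concluding the crux by
name. Disproof used / negatives: as in line `dichotomy` (none exists; ideal corner factored; vocabulary disjoint).
-/

noncomputable section

open MeasureTheory Filter
open scoped ENNReal NNReal ComplexConjugate

namespace Summit.AtomisticToContinuum.BoseEinsteinCondensation.Cruxes.ShellPenetration.ExistenceRigidity

open Literature.MathematicalPhysics.QuantumManyBody.BoseGas

/-! ## Stubs -/

/-- **Stub 1 — the ideal-gas corner at resonance** (as in line `dichotomy`). -/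
theorem stub_idealResonance :
    ∀ v : ℝ → ENNReal, Literature.MathematicalPhysics.QuantumManyBody.BoseGas.IsRepulsiveFiniteRange v → MeasureTheory.volume {r : ℝ | 0 < r ∧ v r ≠ 0} = 0 → ∃ ρ₀ : ℝ, 0 < ρ₀ ∧ ∀ ρ : ℝ, 0 < ρ → ρ < ρ₀ → ∃ w κ c : ℝ, 0 < w ∧ 0 < κ ∧ 0 < c ∧ ∀ᶠ n : ℕ in Filter.atTop, ∃ δ : ENNReal, 0 < δ ∧ let L : ℝ := Literature.MathematicalPhysics.QuantumManyBody.BoseGas.sideLength ρ (n + 1); let g : EuclideanSpace ℝ (Fin 3) → ℂ := Set.indicator {x | (∀ k, x k ∈ Set.Ioo 0 L) ∧ ∃ k, x k ≤ w ∨ L - w ≤ x k} (fun _ => ((Real.sqrt (L ^ 3 - (L - 2 * w) ^ 3))⁻¹ : ℂ)); ∀ Ψ : Literature.MathematicalPhysics.QuantumManyBody.BoseGas.TrialState (n + 1) L, Literature.MathematicalPhysics.QuantumManyBody.BoseGas.energy v Ψ + ENNReal.ofReal κ * ((n + 1 : ENNReal) - Literature.MathematicalPhysics.QuantumManyBody.BoseGas.occupation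 (n + 1) g Ψ.ψ) ≤ (⨅ Φ : Literature.MathematicalPhysics.QuantumManyBody.BoseGas.TrialState (n + 1) L, Literature.MathematicalPhysics.QuantumManyBody.BoseGas.energy v Φ + ENNReal.ofReal κ * ((n + 1 : ENNReal) - Literature.MathematicalPhysics.QuantumManyBody.BoseGas.occupation (n + 1) g Φ.ψ)) + δ → 0 < Literature.MathematicalPhysics.QuantumManyBody.BoseGas.occupation (n + 1) g Ψ.ψ ∧ ∀ z : EuclideanSpace ℝ (Fin 3), (∀ k, z k ∈ Set.Icc (2 * w + 1) (L - 2 * w - 1)) → c * (Literature.MathematicalPhysics.QuantumManyBody.BoseGas.occupation (n + 1) g Ψ.ψ).toReal ≤ ‖(n + 1 : ℂ) * ∫ Y : Fin n → EuclideanSpace ℝ (Fin 3), (∫ x in Metric.ball z 1, Ψ.ψ (Matrix.vecCons x Y)) * conj (∫ x, conj (g x) * Ψ.ψ (Matrix.vecCons x Y))‖ ^ 2 := by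
  sorry

/-- **Stub 2 — reservoir window for the interacting gas** (as in line `dichotomy`). -/
theorem stub_interactingWindow :
    ∀ v : ℝ → ENNReal, Literature.MathematicalPhysics.QuantumManyBody.BoseGas.IsRepulsiveFiniteRange v → MeasureTheory.volume {r : ℝ | 0 < r ∧ v r ≠ 0} ≠ 0 → ∃ ρ₀ : ℝ, 0 < ρ₀ ∧ ∀ ρ : ℝ, 0 < ρ → ρ < ρ₀ → ∃ w κ θ Θ : ℝ, 0 < w ∧ 0 < κ ∧ 0 < θ ∧ ∀ᶠ n : ℕ in Filter.atTop, ∃ δ : ENNReal, 0 < δ ∧ let L : ℝ := Literature.MathematicalPhysics.QuantumManyBody.BoseGas.sideLength ρ (n + 1); let g : EuclideanSpace ℝ (Fin 3) → ℂ := Set.indicator {x | (∀ k, x k ∈ Set.Ioo 0 L) ∧ ∃ k, x k ≤ w ∨ L - w ≤ x k} (fun _ => ((Real.sqrt (L ^ 3 - (L - 2 * w) ^ 3))⁻¹ : ℂ)); ∀ Ψ : Literature.MathematicalPhysics.QuantumManyBody.BoseGas.TrialState (n + 1) L, Literature.MathematicalPhysics.QuantumManyBody.BoseGas.energy v Ψ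 + ENNReal.ofReal κ * ((n + 1 : ENNReal) - Literature.MathematicalPhysics.QuantumManyBody.BoseGas.occupation (n + 1) g Ψ.ψ) ≤ (⨅ Φ : Literature.MathematicalPhysics.QuantumManyBody.BoseGas.TrialState (n + 1) L, Literature.MathematicalPhysics.QuantumManyBody.BoseGas.energy v Φ + ENNReal.ofReal κ * ((n + 1 : ENNReal) - Literature.MathematicalPhysics.QuantumManyBody.BoseGas.occupation (n + 1) g Φ.ψ)) + δ → ENNReal.ofReal (θ * (L ^ 3 - (L - 2 * w) ^ 3)) ≤ Literature.MathematicalPhysics.QuantumManyBody.BoseGas.occupation (n + 1) g Ψ.ψ ∧ Literature.MathematicalPhysics.QuantumManyBody.BoseGas.occupation (n + 1) g Ψ.ψ ≤ ENNReal.ofReal (Θ * (L ^ 3 - (L - 2 * w) ^ 3)) := by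
  sorry

/-- **Stub 3 — EXISTENCE: BEC for the pinned interacting dilute gas, every `(w, κ)`.** For `v` non-zero on a
set of radii of positive measure there is `ρ₀ > 0` such that for `0 < ρ < ρ₀` and all `w, κ > 0` there is
`c_A > 0` with: eventually in `N`, at some slack, every near-minimiser of the shell-pinned energy has
`λ_max(γ_Ψ) ≥ c_A N`. Summit-hard (the thermodynamic-limit condensation problem for a box with a wall term). -/
theorem stub_pinnedBEC :
    ∀ v : ℝ → ENNReal, Literature.MathematicalPhysics.QuantumManyBody.BoseGas.IsRepulsiveFiniteRange v → MeasureTheory.volume {r : ℝ | 0 < r ∧ v r ≠ 0} ≠ 0 → ∃ ρ₀ : ℝ, 0 < ρ₀ ∧ ∀ ρ : ℝ, 0 < ρ → ρ < ρ₀ → ∀ w κ : ℝ, 0 < w → 0 < κ → ∃ cA : ℝ, 0 < cA ∧ ∀ᶠ n : ℕ in Filter.atTop, ∃ δ : ENNReal, 0 < δ ∧ let L : ℝ := Literature.MathematicalPhysics.QuantumManyBody.BoseGas.sideLength ρ (n + 1); let g : EuclideanSpace ℝ (Fin 3) → ℂ := Set.indicator {x | (∀ k, x k ∈ Set.Ioo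 0 L) ∧ ∃ k, x k ≤ w ∨ L - w ≤ x k} (fun _ => ((Real.sqrt (L ^ 3 - (L - 2 * w) ^ 3))⁻¹ : ℂ)); ∀ Ψ : Literature.MathematicalPhysics.QuantumManyBody.BoseGas.TrialState (n + 1) L, Literature.MathematicalPhysics.QuantumManyBody.BoseGas.energy v Ψ + ENNReal.ofReal κ * ((n + 1 : ENNReal) - Literature.MathematicalPhysics.QuantumManyBody.BoseGas.occupation (n + 1) g Ψ.ψ) ≤ (⨅ Φ : Literature.MathematicalPhysics.QuantumManyBody.BoseGas.TrialState (n + 1) L, Literature.MathematicalPhysics.QuantumManyBody.BoseGas.energy v Φ + ENNReal.ofReal κ * ((n + 1 : ENNReal) - Literature.MathematicalPhysics.QuantumManyBody.BoseGas.occupation (n + 1) g Φ.ψ)) + δ → ENNReal.ofReal (cA * (n + 1)) ≤ Literature.MathematicalPhysics.QuantumManyBody.BoseGas.maxOccupation (n + 1) Ψ.ψ := by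
  sorry

/-- **Stub 4 — RIGIDITY: a condensate in a windowed reservoir box penetrates every bulk ball.** For interacting
`v`, small `ρ` and every `(w, κ, θ, Θ, c_A)`: eventual (window ∧ `λ_max ≥ c_A N`) for the near-minimisers ⟹
`∃ c > 0`, eventually every near-minimiser satisfies the crux's per-ball clause. Structure-given-existence:
flatness of the top eigenmode at unit scale, Josephson locking to `g`, cross-term control; positivity and
uniqueness of the exact ground state (`δ` after `n`) are the intended levers. Open, size XL. -/
theorem stub_condensateRigidity :
    ∀ v : ℝ → ENNReal, Literature.MathematicalPhysics.QuantumManyBody.BoseGas.IsRepulsiveFiniteRange v → MeasureTheory.volume {r : ℝ | 0 < r ∧ v r ≠ 0} ≠ 0 → ∃ ρ₀ : ℝ, 0 < ρ₀ ∧ ∀ ρ : ℝ, 0 < ρ → ρ < ρ₀ → ∀ w κ θ Θ cA : ℝ, 0 < w → 0 < κ → 0 < θ → 0 < cA → (∀ᶠ n : ℕ in Filter.atTop, ∃ δ : ENNReal, 0 < δ ∧ let L : ℝ := Literature.MathematicalPhysics.QuantumManyBody.BoseGas.sideLength ρ (n + 1); let g : EuclideanSpace ℝ (Fin 3) → ℂ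 := Set.indicator {x | (∀ k, x k ∈ Set.Ioo 0 L) ∧ ∃ k, x k ≤ w ∨ L - w ≤ x k} (fun _ => ((Real.sqrt (L ^ 3 - (L - 2 * w) ^ 3))⁻¹ : ℂ)); ∀ Ψ : Literature.MathematicalPhysics.QuantumManyBody.BoseGas.TrialState (n + 1) L, Literature.MathematicalPhysics.QuantumManyBody.BoseGas.energy v Ψ + ENNReal.ofReal κ * ((n + 1 : ENNReal) - Literature.MathematicalPhysics.QuantumManyBody.BoseGas.occupation (n + 1) g Ψ.ψ) ≤ (⨅ Φ : Literature.MathematicalPhysics.QuantumManyBody.BoseGas.TrialState (n + 1) L, Literature.MathematicalPhysics.QuantumManyBody.BoseGas.energy v Φ + ENNReal.ofReal κ * ((n + 1 : ENNReal) - Literature.MathematicalPhysics.QuantumManyBody.BoseGas.occupation (n + 1) g Φ.ψ)) + δ → ENNReal.ofReal (θ * (L ^ 3 - (L - 2 * w) ^ 3)) ≤ Literature.MathematicalPhysics.QuantumManyBody.BoseGas.occupation (n + 1) g Ψ.ψ ∧ Literature.MathematicalPhysics.QuantumManyBody.BoseGas.occupation (n + 1) g Ψ.ψ ≤ ENNReal.ofReal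 (Θ * (L ^ 3 - (L - 2 * w) ^ 3)) ∧ ENNReal.ofReal (cA * (n + 1)) ≤ Literature.MathematicalPhysics.QuantumManyBody.BoseGas.maxOccupation (n + 1) Ψ.ψ) → ∃ c : ℝ, 0 < c ∧ ∀ᶠ n : ℕ in Filter.atTop, ∃ δ : ENNReal, 0 < δ ∧ let L : ℝ := Literature.MathematicalPhysics.QuantumManyBody.BoseGas.sideLength ρ (n + 1); let g : EuclideanSpace ℝ (Fin 3) → ℂ := Set.indicator {x | (∀ k, x k ∈ Set.Ioo 0 L) ∧ ∃ k, x k ≤ w ∨ L - w ≤ x k} (fun _ => ((Real.sqrt (L ^ 3 - (L - 2 * w) ^ 3))⁻¹ : ℂ)); ∀ Ψ : Literature.MathematicalPhysics.QuantumManyBody.BoseGas.TrialState (n + 1) L, Literature.MathematicalPhysics.QuantumManyBody.BoseGas.energy v Ψ + ENNReal.ofReal κ * ((n + 1 : ENNReal) - Literature.MathematicalPhysics.QuantumManyBody.BoseGas.occupation (n + 1) g Ψ.ψ) ≤ (⨅ Φ : Literature.MathematicalPhysics.QuantumManyBody.BoseGas.TrialState (n + 1) L, Literature.MathematicalPhysics.QuantumManyBody.BoseGas.energy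 v Φ + ENNReal.ofReal κ * ((n + 1 : ENNReal) - Literature.MathematicalPhysics.QuantumManyBody.BoseGas.occupation (n + 1) g Φ.ψ)) + δ → ∀ z : EuclideanSpace ℝ (Fin 3), (∀ k, z k ∈ Set.Icc (2 * w + 1) (L - 2 * w - 1)) → c * (Literature.MathematicalPhysics.QuantumManyBody.BoseGas.occupation (n + 1) g Ψ.ψ).toReal ≤ ‖(n + 1 : ℂ) * ∫ Y : Fin n → EuclideanSpace ℝ (Fin 3), (∫ x in Metric.ball z 1, Ψ.ψ (Matrix.vecCons x Y)) * conj (∫ x, conj (g x) * Ψ.ψ (Matrix.vecCons x Y))‖ ^ 2 := by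
  sorry

/-! ## Composition (kernel-checked, no `sorry` of its own) -/

/-- The four stub statements imply the crux statement (conclusion = the body of
`Theses.BECBoundaryReservoir.ShellPenetration` verbatim). [folklore] -/
theorem shellPenetration_of_stubs
    (h₁ : ∀ v : ℝ → ENNReal, Literature.MathematicalPhysics.QuantumManyBody.BoseGas.IsRepulsiveFiniteRange v → MeasureTheory.volume {r : ℝ | 0 < r ∧ v r ≠ 0} = 0 → ∃ ρ₀ : ℝ, 0 < ρ₀ ∧ ∀ ρ : ℝ, 0 < ρ → ρ < ρ₀ → ∃ w κ c : ℝ, 0 < w ∧ 0 < κ ∧ 0 < c ∧ ∀ᶠ n : ℕ in Filter.atTop, ∃ δ : ENNReal, 0 < δ ∧ let L : ℝ := Literature.MathematicalPhysics.QuantumManyBody.BoseGas.sideLength ρ (n + 1); let g : EuclideanSpace ℝ (Fin 3) → ℂ := Set.indicator {x | (∀ k, x k ∈ Set.Ioo 0 L) ∧ ∃ k, x k ≤ w ∨ L - w ≤ x k} (fun _ => ((Real.sqrt (L ^ 3 - (L - 2 * w) ^ 3))⁻¹ : ℂ)); ∀ Ψ : Literature.MathematicalPhysics.QuantumManyBody.BoseGas.TrialState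 (n + 1) L, Literature.MathematicalPhysics.QuantumManyBody.BoseGas.energy v Ψ + ENNReal.ofReal κ * ((n + 1 : ENNReal) - Literature.MathematicalPhysics.QuantumManyBody.BoseGas.occupation (n + 1) g Ψ.ψ) ≤ (⨅ Φ : Literature.MathematicalPhysics.QuantumManyBody.BoseGas.TrialState (n + 1) L, Literature.MathematicalPhysics.QuantumManyBody.BoseGas.energy v Φ + ENNReal.ofReal κ * ((n + 1 : ENNReal) - Literature.MathematicalPhysics.QuantumManyBody.BoseGas.occupation (n + 1) g Φ.ψ)) + δ → 0 < Literature.MathematicalPhysics.QuantumManyBody.BoseGas.occupation (n + 1) g Ψ.ψ ∧ ∀ z : EuclideanSpace ℝ (Fin 3), (∀ k, z k ∈ Set.Icc (2 * w + 1) (L - 2 * w - 1)) → c * (Literature.MathematicalPhysics.QuantumManyBody.BoseGas.occupation (n + 1) g Ψ.ψ).toReal ≤ ‖(n + 1 : ℂ) * ∫ Y : Fin n → EuclideanSpace ℝ (Fin 3), (∫ x in Metric.ball z 1, Ψ.ψ (Matrix.vecCons x Y)) * conj (∫ x, conj (g x) * Ψ.ψ (Matrix.vecCons x Y))‖ ^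 2)
    (h₂ : ∀ v : ℝ → ENNReal, Literature.MathematicalPhysics.QuantumManyBody.BoseGas.IsRepulsiveFiniteRange v → MeasureTheory.volume {r : ℝ | 0 < r ∧ v r ≠ 0} ≠ 0 → ∃ ρ₀ : ℝ, 0 < ρ₀ ∧ ∀ ρ : ℝ, 0 < ρ → ρ < ρ₀ → ∃ w κ θ Θ : ℝ, 0 < w ∧ 0 < κ ∧ 0 < θ ∧ ∀ᶠ n : ℕ in Filter.atTop, ∃ δ : ENNReal, 0 < δ ∧ let L : ℝ := Literature.MathematicalPhysics.QuantumManyBody.BoseGas.sideLength ρ (n + 1); let g : EuclideanSpace ℝ (Fin 3) → ℂ := Set.indicator {x | (∀ k, x k ∈ Set.Ioo 0 L) ∧ ∃ k, x k ≤ w ∨ L - w ≤ x k} (fun _ => ((Real.sqrt (L ^ 3 - (L - 2 * w) ^ 3))⁻¹ : ℂ)); ∀ Ψ : Literature.MathematicalPhysics.QuantumManyBody.BoseGas.TrialState (n + 1) L, Literature.MathematicalPhysics.QuantumManyBody.BoseGas.energy v Ψ + ENNReal.ofReal κ * ((n + 1 : ENNReal) - Literature.MathematicalPhysics.QuantumManyBody.BoseGas.occupation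 (n + 1) g Ψ.ψ) ≤ (⨅ Φ : Literature.MathematicalPhysics.QuantumManyBody.BoseGas.TrialState (n + 1) L, Literature.MathematicalPhysics.QuantumManyBody.BoseGas.energy v Φ + ENNReal.ofReal κ * ((n + 1 : ENNReal) - Literature.MathematicalPhysics.QuantumManyBody.BoseGas.occupation (n + 1) g Φ.ψ)) + δ → ENNReal.ofReal (θ * (L ^ 3 - (L - 2 * w) ^ 3)) ≤ Literature.MathematicalPhysics.QuantumManyBody.BoseGas.occupation (n + 1) g Ψ.ψ ∧ Literature.MathematicalPhysics.QuantumManyBody.BoseGas.occupation (n + 1) g Ψ.ψ ≤ ENNReal.ofReal (Θ * (L ^ 3 - (L - 2 * w) ^ 3)))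
    (h₃ : ∀ v : ℝ → ENNReal, Literature.MathematicalPhysics.QuantumManyBody.BoseGas.IsRepulsiveFiniteRange v → MeasureTheory.volume {r : ℝ | 0 < r ∧ v r ≠ 0} ≠ 0 → ∃ ρ₀ : ℝ, 0 < ρ₀ ∧ ∀ ρ : ℝ, 0 < ρ → ρ < ρ₀ → ∀ w κ : ℝ, 0 < w → 0 < κ → ∃ cA : ℝ, 0 < cA ∧ ∀ᶠ n : ℕ in Filter.atTop, ∃ δ : ENNReal, 0 < δ ∧ let L : ℝ := Literature.MathematicalPhysics.QuantumManyBody.BoseGas.sideLength ρ (n + 1); let g : EuclideanSpace ℝ (Fin 3) → ℂ := Set.indicator {x | (∀ k, x k ∈ Set.Ioo 0 L) ∧ ∃ k, x k ≤ w ∨ L - w ≤ x k} (fun _ => ((Real.sqrt (L ^ 3 - (L - 2 * w) ^ 3))⁻¹ : ℂ)); ∀ Ψ : Literature.MathematicalPhysics.QuantumManyBody.BoseGas.TrialState (n + 1) L, Literature.MathematicalPhysics.QuantumManyBody.BoseGas.energy v Ψ + ENNReal.ofReal κ * ((n + 1 : ENNReal) - Literature.MathematicalPhysics.QuantumManyBody.BoseGas.occupation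 (n + 1) g Ψ.ψ) ≤ (⨅ Φ : Literature.MathematicalPhysics.QuantumManyBody.BoseGas.TrialState (n + 1) L, Literature.MathematicalPhysics.QuantumManyBody.BoseGas.energy v Φ + ENNReal.ofReal κ * ((n + 1 : ENNReal) - Literature.MathematicalPhysics.QuantumManyBody.BoseGas.occupation (n + 1) g Φ.ψ)) + δ → ENNReal.ofReal (cA * (n + 1)) ≤ Literature.MathematicalPhysics.QuantumManyBody.BoseGas.maxOccupation (n + 1) Ψ.ψ)
    (h₄ : ∀ v : ℝ → ENNReal, Literature.MathematicalPhysics.QuantumManyBody.BoseGas.IsRepulsiveFiniteRange v → MeasureTheory.volume {r : ℝ | 0 < r ∧ v r ≠ 0} ≠ 0 → ∃ ρ₀ : ℝ, 0 < ρ₀ ∧ ∀ ρ : ℝ, 0 < ρ → ρ < ρ₀ → ∀ w κ θ Θ cA : ℝ, 0 < w → 0 < κ → 0 < θ → 0 < cA → (∀ᶠ n : ℕ in Filter.atTop, ∃ δ : ENNReal, 0 < δ ∧ let L : ℝ := Literature.MathematicalPhysics.QuantumManyBody.BoseGas.sideLength ρ (n + 1); let g : EuclideanSpace ℝ (Fin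 3) → ℂ := Set.indicator {x | (∀ k, x k ∈ Set.Ioo 0 L) ∧ ∃ k, x k ≤ w ∨ L - w ≤ x k} (fun _ => ((Real.sqrt (L ^ 3 - (L - 2 * w) ^ 3))⁻¹ : ℂ)); ∀ Ψ : Literature.MathematicalPhysics.QuantumManyBody.BoseGas.TrialState (n + 1) L, Literature.MathematicalPhysics.QuantumManyBody.BoseGas.energy v Ψ + ENNReal.ofReal κ * ((n + 1 : ENNReal) - Literature.MathematicalPhysics.QuantumManyBody.BoseGas.occupation (n + 1) g Ψ.ψ) ≤ (⨅ Φ : Literature.MathematicalPhysics.QuantumManyBody.BoseGas.TrialState (n + 1) L, Literature.MathematicalPhysics.QuantumManyBody.BoseGas.energy v Φ + ENNReal.ofReal κ * ((n + 1 : ENNReal) - Literature.MathematicalPhysics.QuantumManyBody.BoseGas.occupation (n + 1) g Φ.ψ)) + δ → ENNReal.ofReal (θ * (L ^ 3 - (L - 2 * w) ^ 3)) ≤ Literature.MathematicalPhysics.QuantumManyBody.BoseGas.occupation (n + 1) g Ψ.ψ ∧ Literature.MathematicalPhysics.QuantumManyBody.BoseGas.occupation (n + 1) g Ψ.ψ ≤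 ENNReal.ofReal (Θ * (L ^ 3 - (L - 2 * w) ^ 3)) ∧ ENNReal.ofReal (cA * (n + 1)) ≤ Literature.MathematicalPhysics.QuantumManyBody.BoseGas.maxOccupation (n + 1) Ψ.ψ) → ∃ c : ℝ, 0 < c ∧ ∀ᶠ n : ℕ in Filter.atTop, ∃ δ : ENNReal, 0 < δ ∧ let L : ℝ := Literature.MathematicalPhysics.QuantumManyBody.BoseGas.sideLength ρ (n + 1); let g : EuclideanSpace ℝ (Fin 3) → ℂ := Set.indicator {x | (∀ k, x k ∈ Set.Ioo 0 L) ∧ ∃ k, x k ≤ w ∨ L - w ≤ x k} (fun _ => ((Real.sqrt (L ^ 3 - (L - 2 * w) ^ 3))⁻¹ : ℂ)); ∀ Ψ : Literature.MathematicalPhysics.QuantumManyBody.BoseGas.TrialState (n + 1) L, Literature.MathematicalPhysics.QuantumManyBody.BoseGas.energy v Ψ + ENNReal.ofReal κ * ((n + 1 : ENNReal) - Literature.MathematicalPhysics.QuantumManyBody.BoseGas.occupation (n + 1) g Ψ.ψ) ≤ (⨅ Φ : Literature.MathematicalPhysics.QuantumManyBody.BoseGas.TrialState (n + 1) L, Literature.MathematicalPhysics.QuantumManyBody.BoseGas.energy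 v Φ + ENNReal.ofReal κ * ((n + 1 : ENNReal) - Literature.MathematicalPhysics.QuantumManyBody.BoseGas.occupation (n + 1) g Φ.ψ)) + δ → ∀ z : EuclideanSpace ℝ (Fin 3), (∀ k, z k ∈ Set.Icc (2 * w + 1) (L - 2 * w - 1)) → c * (Literature.MathematicalPhysics.QuantumManyBody.BoseGas.occupation (n + 1) g Ψ.ψ).toReal ≤ ‖(n + 1 : ℂ) * ∫ Y : Fin n → EuclideanSpace ℝ (Fin 3), (∫ x in Metric.ball z 1, Ψ.ψ (Matrix.vecCons x Y)) * conj (∫ x, conj (g x) * Ψ.ψ (Matrix.vecCons x Y))‖ ^ 2) :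
    ∀ v : ℝ → ENNReal, Literature.MathematicalPhysics.QuantumManyBody.BoseGas.IsRepulsiveFiniteRange v → ∃ ρ₀ : ℝ, 0 < ρ₀ ∧ ∀ ρ : ℝ, 0 < ρ → ρ < ρ₀ → ∃ w κ c : ℝ, 0 < w ∧ 0 < κ ∧ 0 < c ∧ ∀ᶠ n : ℕ in Filter.atTop, ∃ δ : ENNReal, 0 < δ ∧ let L : ℝ := Literature.MathematicalPhysics.QuantumManyBody.BoseGas.sideLength ρ (n + 1); let g : EuclideanSpace ℝ (Fin 3) → ℂ := Set.indicator {x | (∀ k, x k ∈ Set.Ioo 0 L) ∧ ∃ k, x k ≤ w ∨ L - w ≤ x k} (fun _ => ((Real.sqrt (L ^ 3 - (L - 2 * w) ^ 3))⁻¹ : ℂ)); ∀ Ψ : Literature.MathematicalPhysics.QuantumManyBody.BoseGas.TrialState (n + 1) L, Literature.MathematicalPhysics.QuantumManyBody.BoseGas.energy v Ψ + ENNReal.ofReal κ * ((n + 1 : ENNReal) - Literature.MathematicalPhysics.QuantumManyBody.BoseGas.occupation (n + 1) g Ψ.ψ) ≤ (⨅ Φ : Literature.MathematicalPhysics.QuantumManyBody.BoseGas.TrialState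 (n + 1) L, Literature.MathematicalPhysics.QuantumManyBody.BoseGas.energy v Φ + ENNReal.ofReal κ * ((n + 1 : ENNReal) - Literature.MathematicalPhysics.QuantumManyBody.BoseGas.occupation (n + 1) g Φ.ψ)) + δ → 0 < Literature.MathematicalPhysics.QuantumManyBody.BoseGas.occupation (n + 1) g Ψ.ψ ∧ ∀ z : EuclideanSpace ℝ (Fin 3), (∀ k, z k ∈ Set.Icc (2 * w + 1) (L - 2 * w - 1)) → c * (Literature.MathematicalPhysics.QuantumManyBody.BoseGas.occupation (n + 1) g Ψ.ψ).toReal ≤ ‖(n + 1 : ℂ) * ∫ Y : Fin n → EuclideanSpace ℝ (Fin 3), (∫ x in Metric.ball z 1, Ψ.ψ (Matrix.vecCons x Y)) * conj (∫ x, conj (g x) * Ψ.ψ (Matrix.vecCons x Y))‖ ^ 2 := by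
  intro v hv
  by_cases hid : MeasureTheory.volume {r : ℝ | 0 < r ∧ v r ≠ 0} = 0
  · exact h₁ v hv hid
  obtain ⟨ρW, hρW, hW⟩ := h₂ v hv hid
  obtain ⟨ρA, hρA, hA⟩ := h₃ v hv hid
  obtain ⟨ρR, hρR, hR⟩ := h₄ v hv hid
  refine ⟨min ρW (min ρA ρR), lt_min hρW (lt_min hρA hρR), fun ρ hρ hρlt => ?_⟩
  have hρltW : ρ < ρW := hρlt.trans_le (min_le_left _ _)
  have hρltA : ρ < ρA := (hρlt.trans_le (min_le_right _ _)).trans_le (min_le_left _ _)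
  have hρltR : ρ < ρR := (hρlt.trans_le (min_le_right _ _)).trans_le (min_le_right _ _)
  -- Stub 2: the window, with its parameters.
  obtain ⟨w, κ, θ, Θ, hw, hκ, hθ, hevW⟩ := hW ρ hρ hρltW
  -- Stub 3: existence of the condensate at these `(w, κ)`.
  obtain ⟨cA, hcA, hevA⟩ := hA ρ hρ hρltA w κ hw hκ
  -- Window ∧ BEC on the intersection of the two eventual sets (slack `min`).
  have hevWA : ∀ᶠ n : ℕ in Filter.atTop, ∃ δ : ENNReal, 0 < δ ∧ let L : ℝ := Literature.MathematicalPhysics.QuantumManyBody.BoseGas.sideLength ρ (n + 1); let g : EuclideanSpace ℝ (Fin 3) → ℂ := Set.indicator {x | (∀ k, x k ∈ Set.Ioo 0 L) ∧ ∃ k, x k ≤ w ∨ L - w ≤ x k} (fun _ => ((Real.sqrt (L ^ 3 - (L - 2 * w) ^ 3))⁻¹ : ℂ)); ∀ Ψ : Literature.MathematicalPhysics.QuantumManyBody.BoseGas.TrialState (n + 1) L, Literature.MathematicalPhysics.QuantumManyBody.BoseGas.energy v Ψ + ENNReal.ofReal κ * ((n + 1 : ENNReal) - Literature.MathematicalPhysics.QuantumManyBody.BoseGas.occupation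 (n + 1) g Ψ.ψ) ≤ (⨅ Φ : Literature.MathematicalPhysics.QuantumManyBody.BoseGas.TrialState (n + 1) L, Literature.MathematicalPhysics.QuantumManyBody.BoseGas.energy v Φ + ENNReal.ofReal κ * ((n + 1 : ENNReal) - Literature.MathematicalPhysics.QuantumManyBody.BoseGas.occupation (n + 1) g Φ.ψ)) + δ → ENNReal.ofReal (θ * (L ^ 3 - (L - 2 * w) ^ 3)) ≤ Literature.MathematicalPhysics.QuantumManyBody.BoseGas.occupation (n + 1) g Ψ.ψ ∧ Literature.MathematicalPhysics.QuantumManyBody.BoseGas.occupation (n + 1) g Ψ.ψ ≤ ENNReal.ofReal (Θ * (L ^ 3 - (L - 2 * w) ^ 3)) ∧ ENNReal.ofReal (cA * (n + 1)) ≤ Literature.MathematicalPhysics.QuantumManyBody.BoseGas.maxOccupation (n + 1) Ψ.ψ := by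
    filter_upwards [hevW, hevA] with n hnW hnA
    obtain ⟨δW, hδW, hnW⟩ := hnW
    obtain ⟨δA, hδA, hnA⟩ := hnA
    refine ⟨min δW δA, lt_min hδW hδA, ?_⟩
    intro L g Ψ hΨ
    have hΨW := hΨ.trans (add_le_add le_rfl (min_le_left δW δA))
    have hΨA := hΨ.trans (add_le_add le_rfl (min_le_right δW δA))
    obtain ⟨hlo, hhi⟩ := hnW Ψ hΨW
    exact ⟨hlo, hhi, hnA Ψ hΨA⟩
  -- Stub 4: rigidity, fed window ∧ BEC.
  obtain ⟨c, hc, hevR⟩ := hR ρ hρ hρltR w κ θ Θ cA hw hκ hθ hcA hevWA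
  refine ⟨w, κ, c, hw, hκ, hc, ?_⟩
  have hvol : ∀ L : ℝ, 0 < θ * (L ^ 3 - (L - 2 * w) ^ 3) := by
    intro L
    have hlt : (L - 2 * w) ^ 3 < L ^ 3 :=
      Odd.strictMono_pow (by decide : Odd 3) (by linarith : L - 2 * w < L)
    exact mul_pos hθ (sub_pos.mpr hlt)
  filter_upwards [hevW, hevR] with n hnW hnR
  obtain ⟨δW, hδW, hnW⟩ := hnW
  obtain ⟨δR, hδR, hnR⟩ := hnR
  refine ⟨min δW δR, lt_min hδW hδR, ?_⟩
  intro L g Ψ hΨ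
  have hΨW := hΨ.trans (add_le_add le_rfl (min_le_left δW δR))
  have hΨR := hΨ.trans (add_le_add le_rfl (min_le_right δW δR))
  obtain ⟨hlo, -⟩ := hnW Ψ hΨW
  refine ⟨lt_of_lt_of_le (ENNReal.ofReal_pos.mpr (hvol L)) hlo, ?_⟩
  exact hnR Ψ hΨR

/-- **`ShellPenetration` from the four stubs** — the crux BY NAME; the stubs' `sorry`s are the only ones in the
file. [folklore] -/
theorem ShellPenetration_of : Theses.BECBoundaryReservoir.ShellPenetration :=
  shellPenetration_of_stubs stub_idealResonance stub_interactingWindow stub_pinnedBEC stub_condensateRigidity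

end Summit.AtomisticToContinuum.BoseEinsteinCondensation.Cruxes.ShellPenetration.ExistenceRigidity

end
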